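import Literature.Combinatorics.LorentzianPolynomials.Diagonalization
import Literature.Combinatorics.LorentzianPolynomials.IndependencePolynomialLorentzian
import Literature.Combinatorics.LorentzianPolynomials.Bivariate
import HarnessLib

/-!
# Mason's conjecture, ultra-log-concave form (Brändén–Huh 2020, Thm. 4.14; Anari–Liu–Oveis Gharan–Vinzant):
# `I_k(M)² / C(n,k)² ≥ I_{k-1}(M) I_{k+1}(M) / (C(n,k-1) C(n,k+1))` for the numbers `I_k(M)` of independent
# `k`-sets of a matroid `M` on `n` elements

Layer `Literature/Combinatorics/LorentzianPolynomials`, namespace `Literature.Combinatorics.LorentzianPolynomials`;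
lane `lit-hodgefound` (Track 2 foundations library), seat p16, generation 28 (row g28-#6). Two definitions with bodies
(`indepNum M k = I_k(M)`, `toBivariate : Option σ → Fin 2` the identification `w_1 = ⋯ = w_n`) and theorems; no named
fact (net debt 0).

## Source (verbatim) — [BrandenHuh2019] P. Brändén, J. Huh, *Lorentzian polynomials*, Ann. of Math. 192 (2020),
## arXiv:1902.03719 (held `paper:arxiv-1902.03719`), §4.3

**Theorem 4.14.** "For any matroid `M` on `[n]` and any positive integer `k`,
`I_k(M)² / C(n,k)² ≥ I_{k+1}(M)/C(n,k+1) · I_{k-1}(M)/C(n,k-1)`, where `I_k(M)` is the number of `k`-element independent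
sets of `M`." (Conjecture 4.13 (3), "the strongest of Mason's conjectures"; "An independent proof of Theorem 4.14 was
given by Anari et al. in [ALOVIII]".) Proof: "The polynomial `f_M` is Lorentzian by Theorem 4.10 and the identity
`f_M(w_0, w_1, …, w_n) = lim_{q→0} Z_{q,M}(w_0, qw_1, …, qw_n)`. Therefore, by Theorem 2.10, the bivariate polynomial
obtained from `f_M` by setting `w_1 = ⋯ = w_n` is Lorentzian. The conclusion follows from the fact that a bivariate
homogeneous polynomial with nonnegative coefficients is Lorentzian if and only if the sequence of coefficients form an
ultra log-concave sequence with no internal zeros." Here `f_M(w_0, w_1, …, w_n) = Σ_{A ∈ 𝓘(M)} w^A w_0^{n-|A|}`.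

## What is proved (exactly along the printed proof, from the tree's ingredients)

`indepGenPoly M = f_M ∈ lorentzian (Option σ) n` is p16 g27-#25 (`indepGenPoly_mem_lorentzian`); "setting
`w_1 = ⋯ = w_n`" is `rename toBivariate` (`w_i ↦ X_0`, `w_0 ↦ X_1`), Lorentzian by Thm. 2.10 (III) in the general form
`rename_mem_lorentzian_of_any` (g28-#5); its coefficient of `X_0^k X_1^{n-k}` is `I_k(M)` (`coeff_rename_indepGenPoly`); and
"bivariate Lorentzian ⟺ ultra log-concave without internal zeros" is `bivariate_mem_lorentzian_iff` (g27-#6). Results: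
**`isUltraLogConcave_indepNum`**, `hasNoInternalZeros_indepNum`, and the displayed inequality **`indepNum_sq_div_ge`**
(Thm. 4.14 as printed, every positive `k`).
-/

noncomputable section

open MvPolynomial Finsupp Finset
open scoped Nat

namespace Literature.Combinatorics.LorentzianPolynomials

variable {σ : Type*} [Fintype σ] [DecidableEq σ]

/-! ## §1 `I_k(M)` and the identification `w_1 = ⋯ = w_n` -/

/-- **`I_k(M)`, the number of `k`-element independent sets of the matroid `M`** on the finite ground type `σ`.
[cite: BrandenHuh2019, §4.3 Thm. 4.14 ("`I_k(M)` is the number of `k`-element independent sets of `M`")] -/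
def indepNum (M : Matroid σ) (k : ℕ) : ℕ := by
  classical exact (((univ : Finset σ).powersetCard k).filter fun I : Finset σ ↦ M.Indep (I : Set σ)).card

omit [DecidableEq σ] in
/-- `I_k(M) = #{I ⊆ σ : |I| = k, I independent}`. [cite: BrandenHuh2019, §4.3 Thm. 4.14] -/
theorem indepNum_def (M : Matroid σ) (k : ℕ) [DecidablePred fun I : Finset σ ↦ M.Indep (I : Set σ)] :
    indepNum M k = (((univ : Finset σ).powersetCard k).filter fun I : Finset σ ↦ M.Indep (I : Set σ)).card := by
  unfold indepNum
  convert rfl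

omit [DecidableEq σ] in
/-- `I_k(M) = 0` for `k > n`. [cite: BrandenHuh2019, §4.3 Thm. 4.14] -/
theorem indepNum_eq_zero_of_lt (M : Matroid σ) {k : ℕ} (hk : Fintype.card σ < k) : indepNum M k = 0 := by
  classical
  rw [indepNum_def, Finset.card_eq_zero, Finset.filter_eq_empty_iff]
  intro I hI
  have h := (Finset.mem_powersetCard.1 hI).2
  have h' : I.card ≤ Fintype.card σ := Finset.card_le_univ I
  omega

/-- **The identification `w_1 = ⋯ = w_n`**: `w_i ↦ X_0` (`some i ↦ 0`) and `w_0 ↦ X_1` (`none ↦ 1`), so that the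
coefficient of `X_0^k X_1^{n-k}` counts the independent `k`-sets. [cite: BrandenHuh2019, §4.3 proof of Thm. 4.14 ("the
bivariate polynomial obtained from `f_M` by setting `w_1 = ⋯ = w_n`")] -/
def toBivariate : Option σ → Fin 2 := fun o ↦ o.elim 1 fun _ ↦ 0

omit [Fintype σ] [DecidableEq σ] in
/-- `toBivariate (some i) = 0`. [cite: BrandenHuh2019, §4.3 proof of Thm. 4.14] -/
@[simp] theorem toBivariate_some (i : σ) : toBivariate (some i) = 0 := rfl

omit [Fintype σ] [DecidableEq σ] in
/-- `toBivariate none = 1`. [cite: BrandenHuh2019, §4.3 proof of Thm. 4.14] -/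
@[simp] theorem toBivariate_none : toBivariate (none : Option σ) = 1 := rfl

omit [DecidableEq σ] in
/-- **The monomial `w^I w_0^{n-|I|}` becomes `X_0^{|I|} X_1^{n-|I|}`**: `toBivariate_* (e^♮_I) = (|I|, n - |I|)`.
[cite: BrandenHuh2019, §4.3 proof of Thm. 4.14] -/
theorem mapDomain_toBivariate_homIndSet (I : Set σ) :
    Finsupp.mapDomain toBivariate (homIndSet I) = bideg I.ncard (Fintype.card σ - I.ncard) := by
  have h1 : Finsupp.mapDomain toBivariate (homIndSet I) 1 = Fintype.card σ - I.ncard := by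
    rw [mapDomain_apply_eq_sum, Finset.sum_filter, Fintype.sum_option, toBivariate_none, if_pos rfl, homIndSet_none,
      Finset.sum_eq_zero fun i _ ↦ by rw [toBivariate_some, if_neg Fin.zero_ne_one]]
    rfl
  have hdeg : (Finsupp.mapDomain toBivariate (homIndSet I)).degree = Fintype.card σ := by
    rw [Finsupp.degree_mapDomain, degree_homIndSet]
  have hle := ncard_le_card I
  rw [eq_bideg (Finsupp.mapDomain toBivariate (homIndSet I)), bideg_eq_bideg_iff]
  rw [degree_eq_add] at hdeg
  omega

/-- **The coefficient of `X_0^k X_1^{n-k}` in `f_M(X_1, X_0, …, X_0)` is `I_k(M)`**. [cite: BrandenHuh2019, §4.3 proof of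
Thm. 4.14 ("the sequence of coefficients")] -/
theorem coeff_rename_toBivariate_indepGenPoly (M : Matroid σ) (k : ℕ) :
    coeff (bideg k (Fintype.card σ - k)) (rename toBivariate (indepGenPoly M)) = indepNum M k := by
  classical
  rw [coeff_rename_eq_sum]
  -- the support of `f_M` is `indepExp M`, with all coefficients `1`
  have hsupp : (indepGenPoly M).support = indepExp M := by
    ext α
    rw [MvPolynomial.mem_support_iff, coeff_indepGenPoly]
    simp
  rw [hsupp]
  have hterm : ∀ α ∈ indepExp M, (if Finsupp.mapDomain toBivariate α = bideg k (Fintype.card σ - k) then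
      coeff α (indepGenPoly M) else 0) =
      if Finsupp.mapDomain toBivariate α = bideg k (Fintype.card σ - k) then (1 : ℝ) else 0 := by
    intro α hα
    rw [coeff_indepGenPoly, if_pos hα]
  rw [Finset.sum_congr rfl hterm, Finset.sum_boole, indepNum_def]
  congr 1
  -- the bijection `I ↦ e^♮_I` between independent `k`-sets and the exponents of `f_M` mapping to `(k, n-k)`
  symm
  refine Finset.card_bij (fun (I : Finset σ) _ ↦ homIndSet (I : Set σ)) ?_ ?_ ?_
  · intro I hI
    rw [Finset.mem_filter] at hI ⊢
    obtain ⟨hIk, hInd⟩ := hI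
    rw [Finset.mem_powersetCard] at hIk
    refine ⟨homIndSet_mem_indepExp.2 hInd, ?_⟩
    rw [mapDomain_toBivariate_homIndSet, Set.ncard_coe_finset, hIk.2]
  · intro I _ J _ h
    exact Finset.coe_injective (homIndSet_injective h)
  · intro α hα
    rw [Finset.mem_filter] at hα
    obtain ⟨hα, hdeg⟩ := hα
    obtain ⟨I, hInd, rfl⟩ := mem_indepExp.1 hα
    rw [mapDomain_toBivariate_homIndSet, bideg_eq_bideg_iff] at hdeg
    refine ⟨(Set.toFinite I).toFinset, ?_, by rw [Set.Finite.coe_toFinset]⟩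
    rw [Finset.mem_filter, Finset.mem_powersetCard, Set.Finite.coe_toFinset]
    refine ⟨⟨Finset.subset_univ _, ?_⟩, hInd⟩
    rw [← Set.ncard_eq_toFinset_card I (Set.toFinite I)]
    exact hdeg.1

/-- **`f_M(X_1, X_0, …, X_0) = Σ_k I_k(M) X_0^k X_1^{n-k}`** — "the bivariate polynomial obtained from `f_M` by setting
`w_1 = ⋯ = w_n`". [cite: BrandenHuh2019, §4.3 proof of Thm. 4.14] -/
theorem rename_toBivariate_indepGenPoly (M : Matroid σ) :
    rename toBivariate (indepGenPoly M) = bivariate (Fintype.card σ) fun k ↦ (indepNum M k : ℝ) := by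
  have hhom : (rename toBivariate (indepGenPoly M)).IsHomogeneous (Fintype.card σ) :=
    (isHomogeneous_indepGenPoly M).rename_isHomogeneous
  rw [eq_bivariate_of_isHomogeneous hhom]
  -- the two coefficient sequences agree on `k ≤ n` (and only those enter `bivariate`)
  rw [bivariate_def, bivariate_def]
  refine Finset.sum_congr rfl fun k _ ↦ ?_
  rw [coeff_rename_toBivariate_indepGenPoly M k]

/-- **"The bivariate polynomial obtained from `f_M` by setting `w_1 = ⋯ = w_n` is Lorentzian"** (Thm. 4.10/`f_M` Lorentzian
+ Thm. 2.10). [cite: BrandenHuh2019, §4.3 proof of Thm. 4.14] -/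
theorem bivariate_indepNum_mem_lorentzian (M : Matroid σ) :
    bivariate (Fintype.card σ) (fun k ↦ (indepNum M k : ℝ)) ∈ lorentzian (Fin 2) (Fintype.card σ) := by
  rw [← rename_toBivariate_indepGenPoly]
  exact rename_mem_lorentzian_of_any toBivariate (indepGenPoly_mem_lorentzian M)

/-! ## §2 Theorem 4.14 -/

/-- **Brändén–Huh, Theorem 4.14 (Mason's conjecture in its strongest, ultra-log-concave form): the numbers `I_k(M)` of
independent `k`-sets of a matroid `M` on `n` elements form an ultra log-concave sequence**, i.e.
`(I_{k-1}/C(n,k-1)) · (I_{k+1}/C(n,k+1)) ≤ (I_k/C(n,k))²` for `0 < k < n`. [cite: BrandenHuh2019, §4.3 Thm. 4.14] -/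
theorem isUltraLogConcave_indepNum (M : Matroid σ) :
    IsUltraLogConcave (Fintype.card σ) fun k ↦ (indepNum M k : ℝ) :=
  ((bivariate_mem_lorentzian_iff fun _ _ ↦ Nat.cast_nonneg _).1 (bivariate_indepNum_mem_lorentzian M)).1

/-- **The sequence `I_k(M)` has no internal zeros** (the other half of "bivariate Lorentzian"). [cite: BrandenHuh2019, §4.3
proof of Thm. 4.14 ("ultra log-concave sequence with no internal zeros")] -/
theorem hasNoInternalZeros_indepNum (M : Matroid σ) :
    HasNoInternalZeros (Fintype.card σ) fun k ↦ (indepNum M k : ℝ) :=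
  ((bivariate_mem_lorentzian_iff fun _ _ ↦ Nat.cast_nonneg _).1 (bivariate_indepNum_mem_lorentzian M)).2

/-- **Theorem 4.14 as displayed: "For any matroid `M` on `[n]` and any positive integer `k`,
`I_k(M)²/C(n,k)² ≥ I_{k+1}(M)/C(n,k+1) · I_{k-1}(M)/C(n,k-1)`."** (For `k ≥ n` the right-hand side vanishes:
`I_{n+1} = 0`, and Lean's `x / 0 = 0` matches `C(n, k+1) = 0`.) [cite: BrandenHuh2019, §4.3 Thm. 4.14] -/
theorem indepNum_sq_div_ge (M : Matroid σ) {k : ℕ} (hk : 0 < k) :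
    ((indepNum M (k + 1) : ℝ) / (Fintype.card σ).choose (k + 1)) *
        ((indepNum M (k - 1) : ℝ) / (Fintype.card σ).choose (k - 1)) ≤
      ((indepNum M k : ℝ) / (Fintype.card σ).choose k) ^ 2 := by
  by_cases hkn : k < Fintype.card σ
  · rw [mul_comm]
    exact isUltraLogConcave_indepNum M k hk hkn
  · rw [indepNum_eq_zero_of_lt M (by omega : Fintype.card σ < k + 1), Nat.cast_zero, zero_div, zero_mul]
    positivity

end Literature.Combinatorics.LorentzianPolynomials

end
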